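import Summits.HodgeConjecture.CorCM.IrreducibleOddWeightsCMFields
import Summits.HodgeConjecture.CorCM.StabiliserOrbitSelfConjugatePartners
import HarnessLib

/-!
# A CM field with irreducible odd weights against ANY partner: the coefficient criterion, the orbit criterion, and
# smaller partners — seat gen 54's (SC)-base theorems on the weaker hypothesis (IRR)

COR-CM (cell `pub-hodgecm2`, binder seat `b16` gen 55, count-neutral claim IRR-ODD, file F4; theorems only, no
definition, no named fact, no `sorry`).  NEW as stated, hence under `Summits/`.  HONEST FRAMING: statements about pairs
of CM types and products of two CM abelian varieties; `HC_CM` is neither used nor asserted — «HC for NAMED classes».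

This seat's exact two-slot criteria (gens 51–53) — Goursat's dichotomy (`PairFlipTransportDichotomy`), the matrix-
coefficient criterion (`PairFlipSlotCoefficientCriterion`), the stabiliser-orbit criterion (`StabiliserOrbitKernel`,
`StabiliserOrbitCriterion`) and the smaller-partner theorem (p2's `CMTypeRankIrreducibleSlot`) — all run on ONE input
about the base slot: `U(Φ₀)` is an IRREDUCIBLE `Aut(ℂ)`-module (`hirr`) plus nondegeneracy of `Φ₀`.  Gen 54
(`StabiliserOrbitSelfConjugatePartners`) dressed them for (SC) base fields, where `U(Φ₀) = Anti` is even ABSOLUTELY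
irreducible.  F1b/F2 of this claim (`IrreducibleOddWeightsCMTypes`, `IrreducibleOddWeightsCMFields`) supply both inputs
from the weaker hypothesis

  (IRR)  every non-zero `Aut(ℂ)`-stable subspace of the odd weights `Anti ≤ ℚ^{Hom(K_{i₀}, ℂ)}` is `Anti`

(`IrrOdd.typeRank_eq_of_irreducible`, `IrrOdd.antiSpan_irreducible_of_irreducible`), so every (SC)-base theorem of gen
54 holds verbatim for an (IRR) base field `K_{i₀}` against ANY CM field `K_{i₁}` (any degree, any position),
`I = {i₀, i₁}` — covering e.g. the eight octic Galois types with (IRR) but not (SC) (closure orders 8, 8, 16, 16, 16, 16,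
24 = `SL₂(𝔽₃)`, 32; gen 54 census, numerics):

* §1 `antiSpan_irreducible_and_isNondegenerate`; **`cmFamilyRank_add_card_eq_iff_not_exists_coeff_of_irreducible`** /
  **`isNondegenerateFamily_iff_not_exists_coeff_of_irreducible`** — additive (`Hg(A₀ × A₁) = Hg(A₀) × Hg(A₁)`) IFF no
  `λ : Hom(K_{i₁}, ℂ) → ℚ` has `Σ_y λ(y) u_{Φ₁}(g ∘ y) = u_{Φ₀}(g ∘ x₀)` for all `g ∈ Aut(ℂ)`;
* §2 **`cmFamilyRank_add_card_eq_iff_not_exists_orbitCoeff_of_irreducible`** /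
  **`isNondegenerateFamily_iff_not_exists_orbitCoeff_of_irreducible`** (`k` homogeneous sets `O_j` under
  `Aut(ℂ/x₀K_{i₀})`, compositum test off them: additive IFF `u_{Φ₀}(· x₀)` is not a combination of the `k` orbit
  shadows) — for the SAME field `K_{i₁} = K_{i₀}` with the `O_j` = `{x₀}` and representatives of the non-self-conjugate
  orbit pairs this is the kit-decidable form of F2's `u_{Φ₀} ∉ D·u_{Φ₁}`; and the ONE-ORBIT forms
  **`cmFamilyRank_add_card_eq_iff_of_irreducible_of_orbit`** / **`isNondegenerateFamily_iff_of_irreducible_of_orbit`**;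
* §3 SMALLER PARTNERS: `pairwise_of_irreducible_of_finrank_lt` and
  **`isNondegenerateFamily_iff_of_irreducible_of_finrank_lt`** — `[K_{i₁}:ℚ] < [K_{i₀}:ℚ]` ⟹ the pair is nondegenerate
  IFF `Φ₁` is (an (IRR) field of degree `2n` pairs additively with every CM abelian variety of dimension `< n`);
* §4 abelian varieties: **`hodgeConjectureFor_prod_of_irreducible_of_orbit`**, `…_of_not_exists_coeff`,
  **`hodgeConjectureFor_prod_of_irreducible_of_dim_lt`** (the Hodge conjecture with `B• = D•` on every `A₀^a × A₁^b`,
  UNCONDITIONALLY, in the additive cases), **`forall_prod_hodgeClassSpan_eq_iff_of_irreducible_of_orbit`** (simple,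
  non-isogenous: `B• = D•` on all products IFF …), `forall_prod_hodgeClassSpan_eq_iff_of_irreducible_coeff`.

## References

* [Gordon1999HodgeAVSurvey] B. B. Gordon, *A survey of the Hodge conjecture for abelian varieties*, §3 Theorem (Imai,
  Murty) with proof, 7.4–7.7, 9.4.3, 10.10.
* [Serre1977] J.-P. Serre, *Linear Representations of Finite Groups*, GTM 42, §2.2, §7.2–7.4.
* [Dodson1984] B. Dodson, *The structure of Galois groups of CM-fields*, Trans. AMS 283 (1984), §1.1, §5.1.2.
* [Wielandt1964] H. Wielandt, *Finite Permutation Groups* (1964), Thm. 28.4.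
-/

set_option autoImplicit false

noncomputable section

open scoped BigOperators

namespace Summit.HodgeConjecture.CorCM

open CategoryTheory CategoryTheory.Limits NumberField Module
open Literature.NumberTheory.ComplexMultiplication
open Literature.AlgebraicGeometry.Motives (AbelianVariety CMType)
open Literature.AlgebraicGeometry.HodgeTheory
open Literature.AlgebraicGeometry.ComplexMultiplication (IsCMTypeRealisation)
open Literature.AlgebraicGeometry.VanGeemen1994 (hodgeClassSpan)
open Literature.AlgebraicGeometry.Pohlmann1968
open Literature.Barriers.HodgeConjecture (divisorClassesSpan)
open scoped Classical

variable {I : Type} {K : I → Type} [∀ i, Field (K i)] [∀ i, NumberField (K i)] [∀ i, IsCMField (K i)]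

omit [∀ i, IsCMField (K i)] in
/-- `|⊔_i Hom(K_i, ℂ)| = Σ_i [K_i : ℚ]`. [folklore] -/
private theorem card_sigma_ringHom_eq_sum₅₅ [Fintype I] :
    Fintype.card ((i : I) × (K i →+* ℂ)) = ∑ i, finrank ℚ (K i) := by
  rw [Fintype.card_sigma]
  exact Finset.sum_congr rfl fun i _ => Embeddings.card (K i) ℂ

/-! ### §1 Irreducibility and the coefficient criterion -/

section Coefficient

/-- **An (IRR) slot: `U(Φ)` irreducible of dimension `[K:ℚ]/2`, `Φ` nondegenerate** — the three inputs of this seat's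
two-slot criteria, for EVERY CM type of the field. [cite: Wielandt1964, Thm. 28.4] [cite: Serre1977, §2.2] -/
theorem antiSpan_irreducible_and_isNondegenerate (Φ : ∀ i, CMType (K i)) {i : I}
    (hirr : ∀ W : Submodule ℚ ((K i →+* ℂ) → ℚ), W ≤ antiWeights (E := K i →+* ℂ) (starRingAut : ℂ ≃+* ℂ) →
      W ≠ ⊥ → (∀ (k : ℂ ≃+* ℂ) (f : (K i →+* ℂ) → ℚ), f ∈ W → (fun y => f (k • y)) ∈ W) →
      W = antiWeights (E := K i →+* ℂ) (starRingAut : ℂ ≃+* ℂ)) :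
    (∀ W : Submodule ℚ ((K i →+* ℂ) → ℚ), W ≤ antiSpan (ℂ ≃+* ℂ) (Φ i).1 → W ≠ ⊥ →
      (∀ (k : ℂ ≃+* ℂ) (f : (K i →+* ℂ) → ℚ), f ∈ W → (fun y => f (k • y)) ∈ W) → W = antiSpan (ℂ ≃+* ℂ) (Φ i).1) ∧
    finrank ℚ (antiSpan (ℂ ≃+* ℂ) (Φ i).1) = finrank ℚ (K i) / 2 ∧ IsNondegenerate (Φ i) := by
  have hnd : IsNondegenerate (Φ i) := by
    rw [isNondegenerate_iff, cmTypeRank, ← Embeddings.card (K i) ℂ]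
    exact IrrOdd.typeRank_eq_of_irreducible (isCMTypeWith_conj (Φ i)) hirr
  exact ⟨IrrOdd.antiSpan_irreducible_of_irreducible (isCMTypeWith_conj (Φ i)) hirr,
    (finrank_antiSpan_eq_iff_isNondegenerate i).2 hnd, hnd⟩

variable [Fintype I] [DecidableEq I] {Φ : ∀ i, CMType (K i)} {i₀ i₁ : I}

/-- **THE COEFFICIENT CRITERION for an (IRR) field against ANY CM field (rank form).**  `I = {i₀, i₁}`, `K_{i₀}` with (IRR),
`K_{i₁}` ANY CM field, `x₀ : K_{i₀} → ℂ` any embedding: `rank(Φ₀, Φ₁) + 2 = rank Φ₀ + rank Φ₁ + 1`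
(`Hg(A₀ × A₁) = Hg(A₀) × Hg(A₁)`) IFF no `λ : Hom(K_{i₁}, ℂ) → ℚ` has `Σ_y λ(y) u_{Φ₁}(g ∘ y) = u_{Φ₀}(g ∘ x₀)` for all
`g ∈ Aut(ℂ)`. [cite: Gordon1999HodgeAVSurvey, §3 Theorem (1) and 7.5–7.7] [cite: Serre1977, §7.2] -/
theorem cmFamilyRank_add_card_eq_iff_not_exists_coeff_of_irreducible (hI : ∀ i, i = i₀ ∨ i = i₁) (h01 : i₀ ≠ i₁)
    (hirr : ∀ W : Submodule ℚ ((K i₀ →+* ℂ) → ℚ), W ≤ antiWeights (E := K i₀ →+* ℂ) (starRingAut : ℂ ≃+* ℂ) →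
      W ≠ ⊥ → (∀ (k : ℂ ≃+* ℂ) (f : (K i₀ →+* ℂ) → ℚ), f ∈ W → (fun y => f (k • y)) ∈ W) →
      W = antiWeights (E := K i₀ →+* ℂ) (starRingAut : ℂ ≃+* ℂ)) (x₀ : K i₀ →+* ℂ) :
    CMAlgebra.cmFamilyRank Φ + Fintype.card I = (∑ i, cmTypeRank (Φ i)) + 1 ↔
      ¬ ∃ lam : (K i₁ →+* ℂ) → ℚ, ∀ g : ℂ ≃+* ℂ,
        ∑ y, lam y * antiVec (Φ i₁).1 (1 : ℂ ≃+* ℂ) (g • y) = antiVec (Φ i₀).1 (1 : ℂ ≃+* ℂ) (g • x₀) := by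
  haveI : Nonempty I := ⟨i₀⟩
  exact Shadow.typeRank_sigmaType_add_card_eq_iff_not_exists_coeff (G := ℂ ≃+* ℂ) (Φ := fun i => (Φ i).1)
    (fun i => isCMTypeWith_conj (Φ i)) hI h01 (antiSpan_irreducible_and_isNondegenerate Φ hirr).1 x₀

/-- **Nondegeneracy form**: `K_{i₀}` with (IRR), `K_{i₁}` any CM field: the pair `(Φ₀, Φ₁)` is nondegenerate IFF `Φ₁` is
nondegenerate and no coefficient vector `λ` exists. [cite: Gordon1999HodgeAVSurvey, 7.5–7.7] -/
theorem isNondegenerateFamily_iff_not_exists_coeff_of_irreducible (hI : ∀ i, i = i₀ ∨ i = i₁) (h01 : i₀ ≠ i₁)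
    (hirr : ∀ W : Submodule ℚ ((K i₀ →+* ℂ) → ℚ), W ≤ antiWeights (E := K i₀ →+* ℂ) (starRingAut : ℂ ≃+* ℂ) →
      W ≠ ⊥ → (∀ (k : ℂ ≃+* ℂ) (f : (K i₀ →+* ℂ) → ℚ), f ∈ W → (fun y => f (k • y)) ∈ W) →
      W = antiWeights (E := K i₀ →+* ℂ) (starRingAut : ℂ ≃+* ℂ)) (x₀ : K i₀ →+* ℂ) :
    CMAlgebra.IsNondegenerateFamily Φ ↔ IsNondegenerate (Φ i₁) ∧
      ¬ ∃ lam : (K i₁ →+* ℂ) → ℚ, ∀ g : ℂ ≃+* ℂ,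
        ∑ y, lam y * antiVec (Φ i₁).1 (1 : ℂ ≃+* ℂ) (g • y) = antiVec (Φ i₀).1 (1 : ℂ ≃+* ℂ) (g • x₀) := by
  haveI : Nonempty I := ⟨i₀⟩
  have hnd₀ : typeRank (ℂ ≃+* ℂ) (Φ i₀).1 = Fintype.card (K i₀ →+* ℂ) / 2 + 1 :=
    IrrOdd.typeRank_eq_of_irreducible (isCMTypeWith_conj (Φ i₀)) hirr
  have key := Shadow.typeRank_sigmaType_eq_iff_not_exists_coeff (G := ℂ ≃+* ℂ) (Φ := fun i => (Φ i).1)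
    (fun i => isCMTypeWith_conj (Φ i)) hI h01 (antiSpan_irreducible_and_isNondegenerate Φ hirr).1 hnd₀ x₀
  rw [CMAlgebra.isNondegenerateFamily_iff, ← card_sigma_ringHom_eq_sum₅₅ (K := K), isNondegenerate_iff, cmTypeRank,
    ← Embeddings.card (K i₁) ℂ]
  exact key

end Coefficient

/-! ### §2 The orbit criterion -/

section Orbit

variable [Fintype I] [DecidableEq I] {Φ : ∀ i, CMType (K i)} {i₀ i₁ : I}

/-- **THE `k`-ORBIT CRITERION for an (IRR) base (rank form)**: orbit data `(O_j)_j` at `x₀` — each `O_j` homogeneous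
under `Aut(ℂ / x₀K_{i₀})`, separated, compositum test off `⋃_j (O_j ∪ Ō_j)`: additive IFF there are NO constants
`c_j ∈ ℚ` with `u_{Φ₀}(g ∘ x₀) = Σ_j c_j Σ_{y∈O_j} u_{Φ₁}(g ∘ y)` for all `g ∈ Aut(ℂ)`.
[cite: Gordon1999HodgeAVSurvey, §3 Theorem (1) and 7.5–7.7] [cite: Serre1977, §7.2–7.4] -/
theorem cmFamilyRank_add_card_eq_iff_not_exists_orbitCoeff_of_irreducible (hI : ∀ i, i = i₀ ∨ i = i₁) (h01 : i₀ ≠ i₁)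
    (hirr : ∀ W : Submodule ℚ ((K i₀ →+* ℂ) → ℚ), W ≤ antiWeights (E := K i₀ →+* ℂ) (starRingAut : ℂ ≃+* ℂ) →
      W ≠ ⊥ → (∀ (k : ℂ ≃+* ℂ) (f : (K i₀ →+* ℂ) → ℚ), f ∈ W → (fun y => f (k • y)) ∈ W) →
      W = antiWeights (E := K i₀ →+* ℂ) (starRingAut : ℂ ≃+* ℂ))
    {x₀ : K i₀ →+* ℂ} {κ : Type} [Fintype κ] (O : κ → Set (K i₁ →+* ℂ))
    (hO : ∀ j, ∀ y ∈ O j, ∀ y' ∈ O j, ∃ g : ℂ ≃+* ℂ, g • x₀ = x₀ ∧ g • y = y')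
    (hdisj : ∀ j j', j ≠ j' → ∀ y ∈ O j, y ∉ O j' ∧ (starRingAut : ℂ ≃+* ℂ) • y ∉ O j')
    (hoff : ∀ y : K i₁ →+* ℂ, (∀ j, y ∉ O j ∧ (starRingAut : ℂ ≃+* ℂ) • y ∉ O j) →
      ∃ σ : ℂ ≃+* ℂ, σ • x₀ = (starRingAut : ℂ ≃+* ℂ) • x₀ ∧ σ • y = y) :
    CMAlgebra.cmFamilyRank Φ + Fintype.card I = (∑ i, cmTypeRank (Φ i)) + 1 ↔
      ¬ ∃ c : κ → ℚ, ∀ g : ℂ ≃+* ℂ, antiVec (Φ i₀).1 (1 : ℂ ≃+* ℂ) (g • x₀) =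
        ∑ j, c j * ∑ y ∈ Finset.univ.filter (fun y : K i₁ →+* ℂ => y ∈ O j),
          antiVec (Φ i₁).1 (1 : ℂ ≃+* ℂ) (g • y) := by
  haveI : Nonempty I := ⟨i₀⟩
  exact Shadow.typeRank_sigmaType_add_card_eq_iff_not_exists_orbitCoeff (G := ℂ ≃+* ℂ) (Φ := fun i => (Φ i).1)
    (fun i => isCMTypeWith_conj (Φ i)) hI h01 (antiSpan_irreducible_and_isNondegenerate Φ hirr).1 O hO hdisj hoff

/-- **THE `k`-ORBIT CRITERION for an (IRR) base (nondegeneracy form)**: the pair is nondegenerate IFF `Φ₁` is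
nondegenerate and no orbit constants exist. [cite: Gordon1999HodgeAVSurvey, 7.5–7.7] [cite: Serre1977, §7.2–7.4] -/
theorem isNondegenerateFamily_iff_not_exists_orbitCoeff_of_irreducible (hI : ∀ i, i = i₀ ∨ i = i₁) (h01 : i₀ ≠ i₁)
    (hirr : ∀ W : Submodule ℚ ((K i₀ →+* ℂ) → ℚ), W ≤ antiWeights (E := K i₀ →+* ℂ) (starRingAut : ℂ ≃+* ℂ) →
      W ≠ ⊥ → (∀ (k : ℂ ≃+* ℂ) (f : (K i₀ →+* ℂ) → ℚ), f ∈ W → (fun y => f (k • y)) ∈ W) →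
      W = antiWeights (E := K i₀ →+* ℂ) (starRingAut : ℂ ≃+* ℂ))
    {x₀ : K i₀ →+* ℂ} {κ : Type} [Fintype κ] (O : κ → Set (K i₁ →+* ℂ))
    (hO : ∀ j, ∀ y ∈ O j, ∀ y' ∈ O j, ∃ g : ℂ ≃+* ℂ, g • x₀ = x₀ ∧ g • y = y')
    (hdisj : ∀ j j', j ≠ j' → ∀ y ∈ O j, y ∉ O j' ∧ (starRingAut : ℂ ≃+* ℂ) • y ∉ O j')
    (hoff : ∀ y : K i₁ →+* ℂ, (∀ j, y ∉ O j ∧ (starRingAut : ℂ ≃+* ℂ) • y ∉ O j) →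
      ∃ σ : ℂ ≃+* ℂ, σ • x₀ = (starRingAut : ℂ ≃+* ℂ) • x₀ ∧ σ • y = y) :
    CMAlgebra.IsNondegenerateFamily Φ ↔ IsNondegenerate (Φ i₁) ∧
      ¬ ∃ c : κ → ℚ, ∀ g : ℂ ≃+* ℂ, antiVec (Φ i₀).1 (1 : ℂ ≃+* ℂ) (g • x₀) =
        ∑ j, c j * ∑ y ∈ Finset.univ.filter (fun y : K i₁ →+* ℂ => y ∈ O j),
          antiVec (Φ i₁).1 (1 : ℂ ≃+* ℂ) (g • y) := by
  haveI : Nonempty I := ⟨i₀⟩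
  have hnd₀ : typeRank (ℂ ≃+* ℂ) (Φ i₀).1 = Fintype.card (K i₀ →+* ℂ) / 2 + 1 :=
    IrrOdd.typeRank_eq_of_irreducible (isCMTypeWith_conj (Φ i₀)) hirr
  have key := Shadow.typeRank_sigmaType_eq_iff_not_exists_orbitCoeff (G := ℂ ≃+* ℂ) (Φ := fun i => (Φ i).1)
    (fun i => isCMTypeWith_conj (Φ i)) hI h01 (antiSpan_irreducible_and_isNondegenerate Φ hirr).1 hnd₀ O hO hdisj hoff
  rw [CMAlgebra.isNondegenerateFamily_iff, ← card_sigma_ringHom_eq_sum₅₅ (K := K), isNondegenerate_iff, cmTypeRank,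
    ← Embeddings.card (K i₁) ℂ]
  exact key

/-- **THE ONE-ORBIT CRITERION for an (IRR) base (rank form)**: `O ⊆ Hom(K_{i₁}, ℂ)` homogeneous under
`Aut(ℂ / x₀K_{i₀})`, compositum test off `O ∪ Ō`: additive IFF the orbit multiplicities `#{y ∈ O : g ∘ y ∈ Φ₁}` are NOT
`a` when `g ∘ x₀ ∈ Φ₀`, `b` otherwise, with `a ≠ b`. [cite: Gordon1999HodgeAVSurvey, §3 Theorem (1), 7.5–7.7 and 9.4.3]
[cite: Dodson1984, §5.1.2] -/
theorem cmFamilyRank_add_card_eq_iff_of_irreducible_of_orbit (hI : ∀ i, i = i₀ ∨ i = i₁) (h01 : i₀ ≠ i₁)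
    (hirr : ∀ W : Submodule ℚ ((K i₀ →+* ℂ) → ℚ), W ≤ antiWeights (E := K i₀ →+* ℂ) (starRingAut : ℂ ≃+* ℂ) →
      W ≠ ⊥ → (∀ (k : ℂ ≃+* ℂ) (f : (K i₀ →+* ℂ) → ℚ), f ∈ W → (fun y => f (k • y)) ∈ W) →
      W = antiWeights (E := K i₀ →+* ℂ) (starRingAut : ℂ ≃+* ℂ))
    {x₀ : K i₀ →+* ℂ} (O : Set (K i₁ →+* ℂ)) (hO : ∀ y ∈ O, ∀ y' ∈ O, ∃ g : ℂ ≃+* ℂ, g • x₀ = x₀ ∧ g • y = y')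
    (hoff : ∀ y : K i₁ →+* ℂ, y ∉ O → (starRingAut : ℂ ≃+* ℂ) • y ∉ O →
      ∃ σ : ℂ ≃+* ℂ, σ • x₀ = (starRingAut : ℂ ≃+* ℂ) • x₀ ∧ σ • y = y) :
    CMAlgebra.cmFamilyRank Φ + Fintype.card I = (∑ i, cmTypeRank (Φ i)) + 1 ↔
      ¬ ∃ a b : ℕ, a ≠ b ∧ ∀ g : ℂ ≃+* ℂ,
        (Finset.univ.filter fun y : K i₁ →+* ℂ => y ∈ O ∧ g • y ∈ (Φ i₁).1).card =
          if g • x₀ ∈ (Φ i₀).1 then a else b := by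
  haveI : Nonempty I := ⟨i₀⟩
  exact Shadow.typeRank_sigmaType_add_card_eq_iff_not_exists_orbitMultiplicities (G := ℂ ≃+* ℂ)
    (Φ := fun i => (Φ i).1) (fun i => isCMTypeWith_conj (Φ i)) hI h01
    (antiSpan_irreducible_and_isNondegenerate Φ hirr).1 O hO hoff

/-- **THE ONE-ORBIT CRITERION for an (IRR) base (nondegeneracy form)**: the pair is nondegenerate IFF `Φ₁` is
nondegenerate and its orbit multiplicities on `O` are not constant-unequal.
[cite: Gordon1999HodgeAVSurvey, 7.5–7.7 and 9.4.3] [cite: Dodson1984, §5.1.2] -/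
theorem isNondegenerateFamily_iff_of_irreducible_of_orbit (hI : ∀ i, i = i₀ ∨ i = i₁) (h01 : i₀ ≠ i₁)
    (hirr : ∀ W : Submodule ℚ ((K i₀ →+* ℂ) → ℚ), W ≤ antiWeights (E := K i₀ →+* ℂ) (starRingAut : ℂ ≃+* ℂ) →
      W ≠ ⊥ → (∀ (k : ℂ ≃+* ℂ) (f : (K i₀ →+* ℂ) → ℚ), f ∈ W → (fun y => f (k • y)) ∈ W) →
      W = antiWeights (E := K i₀ →+* ℂ) (starRingAut : ℂ ≃+* ℂ))
    {x₀ : K i₀ →+* ℂ} (O : Set (K i₁ →+* ℂ)) (hO : ∀ y ∈ O, ∀ y' ∈ O, ∃ g : ℂ ≃+* ℂ, g • x₀ = x₀ ∧ g • y = y')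
    (hoff : ∀ y : K i₁ →+* ℂ, y ∉ O → (starRingAut : ℂ ≃+* ℂ) • y ∉ O →
      ∃ σ : ℂ ≃+* ℂ, σ • x₀ = (starRingAut : ℂ ≃+* ℂ) • x₀ ∧ σ • y = y) :
    CMAlgebra.IsNondegenerateFamily Φ ↔ IsNondegenerate (Φ i₁) ∧
      ¬ ∃ a b : ℕ, a ≠ b ∧ ∀ g : ℂ ≃+* ℂ,
        (Finset.univ.filter fun y : K i₁ →+* ℂ => y ∈ O ∧ g • y ∈ (Φ i₁).1).card =
          if g • x₀ ∈ (Φ i₀).1 then a else b := by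
  haveI : Nonempty I := ⟨i₀⟩
  have hnd₀ : typeRank (ℂ ≃+* ℂ) (Φ i₀).1 = Fintype.card (K i₀ →+* ℂ) / 2 + 1 :=
    IrrOdd.typeRank_eq_of_irreducible (isCMTypeWith_conj (Φ i₀)) hirr
  have key := Shadow.typeRank_sigmaType_eq_iff_not_exists_orbitMultiplicities (G := ℂ ≃+* ℂ)
    (Φ := fun i => (Φ i).1) (fun i => isCMTypeWith_conj (Φ i)) hI h01
    (antiSpan_irreducible_and_isNondegenerate Φ hirr).1 hnd₀ O hO hoff
  rw [CMAlgebra.isNondegenerateFamily_iff, ← card_sigma_ringHom_eq_sum₅₅ (K := K), isNondegenerate_iff, cmTypeRank,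
    ← Embeddings.card (K i₁) ℂ]
  exact key

end Orbit

/-! ### §3 Smaller partners -/

section Smaller

/-- **An (IRR) field against ANY field of smaller degree: no common constituent** (both orders): `U(Φ_i)` is irreducible
of dimension `[K_i:ℚ]/2 > [K_j:ℚ]/2 ≥ dim U(Φ_j)` — criterion (α) of the tree.
[cite: Gordon1999HodgeAVSurvey, §3 Theorem (proof)] [cite: Serre1977, §2.2] -/
theorem pairwise_of_irreducible_of_finrank_lt (Φ : ∀ i, CMType (K i)) {i j : I}
    (hirr : ∀ W : Submodule ℚ ((K i →+* ℂ) → ℚ), W ≤ antiWeights (E := K i →+* ℂ) (starRingAut : ℂ ≃+* ℂ) →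
      W ≠ ⊥ → (∀ (k : ℂ ≃+* ℂ) (f : (K i →+* ℂ) → ℚ), f ∈ W → (fun y => f (k • y)) ∈ W) →
      W = antiWeights (E := K i →+* ℂ) (starRingAut : ℂ ≃+* ℂ))
    (hlt : finrank ℚ (K j) < finrank ℚ (K i)) :
    (∀ P : Submodule ℚ ((K j →+* ℂ) → ℚ), P ≤ antiSpan (ℂ ≃+* ℂ) (Φ j).1 →
      (∀ g : ℂ ≃+* ℂ, ∀ f ∈ P, (fun x => f (g • x)) ∈ P) →
      ∀ T : ((K j →+* ℂ) → ℚ) →ₗ[ℚ] ((K i →+* ℂ) → ℚ),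
        (∀ g : ℂ ≃+* ℂ, ∀ f ∈ P, T (fun x => f (g • x)) = fun y => T f (g • y)) →
        (∀ f ∈ P, T f ∈ antiSpan (ℂ ≃+* ℂ) (Φ i).1) → (∀ f ∈ P, T f = 0 → f = 0) → P = ⊥) ∧
    (∀ P : Submodule ℚ ((K i →+* ℂ) → ℚ), P ≤ antiSpan (ℂ ≃+* ℂ) (Φ i).1 →
      (∀ g : ℂ ≃+* ℂ, ∀ f ∈ P, (fun x => f (g • x)) ∈ P) →
      ∀ T : ((K i →+* ℂ) → ℚ) →ₗ[ℚ] ((K j →+* ℂ) → ℚ),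
        (∀ g : ℂ ≃+* ℂ, ∀ f ∈ P, T (fun x => f (g • x)) = fun y => T f (g • y)) →
        (∀ f ∈ P, T f ∈ antiSpan (ℂ ≃+* ℂ) (Φ j).1) → (∀ f ∈ P, T f = 0 → f = 0) → P = ⊥) := by
  obtain ⟨hirr, hdim, -⟩ := antiSpan_irreducible_and_isNondegenerate Φ hirr
  have hi2 := Literature.AlgebraicGeometry.Motives.HodgeStructure.two_mul_ncard_cmType_eq_finrank (Φ i)
  have hlt' : finrank ℚ (antiSpan (ℂ ≃+* ℂ) (Φ j).1) < finrank ℚ (antiSpan (ℂ ≃+* ℂ) (Φ i).1) := by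
    have h1 := finrank_antiSpan_le_finrank_div_two (Φ := Φ) j
    rw [hdim]; omega
  exact pairwise_of_irreducible_of_finrank_le (G := ℂ ≃+* ℂ) (Φ := fun i => (Φ i).1) hirr hlt'.le
    (fun h => absurd h hlt'.ne)

variable [Fintype I] [DecidableEq I]

/-- **Two slots, an (IRR) field against any CM field of smaller degree: nondegenerate iff the smaller type is** — an (IRR)
field of degree `2n` pairs additively with EVERY CM abelian variety of dimension `< n` (no shared-subfield clause: an (IRR)
field of degree `≥ 4` has no imaginary quadratic subfield to share). [cite: Gordon1999HodgeAVSurvey, §3 Theorem and 7.5–7.7] -/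
theorem isNondegenerateFamily_iff_of_irreducible_of_finrank_lt {i₀ i₁ : I} (h01 : i₀ ≠ i₁)
    (hI : ∀ j, j = i₀ ∨ j = i₁)
    (hirr : ∀ W : Submodule ℚ ((K i₀ →+* ℂ) → ℚ), W ≤ antiWeights (E := K i₀ →+* ℂ) (starRingAut : ℂ ≃+* ℂ) →
      W ≠ ⊥ → (∀ (k : ℂ ≃+* ℂ) (f : (K i₀ →+* ℂ) → ℚ), f ∈ W → (fun y => f (k • y)) ∈ W) →
      W = antiWeights (E := K i₀ →+* ℂ) (starRingAut : ℂ ≃+* ℂ))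
    (hlt : finrank ℚ (K i₁) < finrank ℚ (K i₀)) (Φ : ∀ i, CMType (K i)) :
    CMAlgebra.IsNondegenerateFamily Φ ↔ IsNondegenerate (Φ i₁) := by
  haveI : Nonempty I := ⟨i₀⟩
  have hnd₀ := (antiSpan_irreducible_and_isNondegenerate Φ hirr).2.2
  have hab := pairwise_of_irreducible_of_finrank_lt Φ hirr hlt
  rw [isNondegenerateFamily_iff_forall_of_pairwise Φ fun i j hij => ?_]
  · refine ⟨fun H => H i₁, fun H i => ?_⟩
    rcases hI i with rfl | rfl
    · exact hnd₀
    · exact H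
  · rcases hI i with rfl | rfl <;> rcases hI j with rfl | rfl
    · exact absurd rfl hij
    · exact hab.2
    · exact hab.1
    · exact absurd rfl hij

end Smaller

/-! ### §4 Abelian varieties -/

section Varieties

variable [Fintype I] [DecidableEq I] [Nonempty I] {Φ : ∀ i, CMType (K i)} {i₀ i₁ : I} {A : I → AbelianVariety ℂ}
  {ι : ∀ i, 𝓞 (K i) →+* End (A i)} {θ : ∀ i, K i →+* Module.End ℂ (complexBetti (A i).X 1)}

/-- **The Hodge conjecture on every `A₀^a × A₁^b`** (every `⨁_{j<N} A_{π j}`), with `B• = D•` there, for a realisation of a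
type of an (IRR) field and a realisation of a NONDEGENERATE type of ANY CM field whose orbit multiplicities on a
homogeneous `O` (compositum test off `O ∪ Ō`) are not constant-unequal — UNCONDITIONALLY.
[cite: Gordon1999HodgeAVSurvey, 7.5 and 10.10] -/
theorem hodgeConjectureFor_prod_of_irreducible_of_orbit (hI : ∀ i, i = i₀ ∨ i = i₁) (h01 : i₀ ≠ i₁)
    (hirr : ∀ W : Submodule ℚ ((K i₀ →+* ℂ) → ℚ), W ≤ antiWeights (E := K i₀ →+* ℂ) (starRingAut : ℂ ≃+* ℂ) →
      W ≠ ⊥ → (∀ (k : ℂ ≃+* ℂ) (f : (K i₀ →+* ℂ) → ℚ), f ∈ W → (fun y => f (k • y)) ∈ W) →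
      W = antiWeights (E := K i₀ →+* ℂ) (starRingAut : ℂ ≃+* ℂ))
    {x₀ : K i₀ →+* ℂ} (O : Set (K i₁ →+* ℂ)) (hO : ∀ y ∈ O, ∀ y' ∈ O, ∃ g : ℂ ≃+* ℂ, g • x₀ = x₀ ∧ g • y = y')
    (hoff : ∀ y : K i₁ →+* ℂ, y ∉ O → (starRingAut : ℂ ≃+* ℂ) • y ∉ O →
      ∃ σ : ℂ ≃+* ℂ, σ • x₀ = (starRingAut : ℂ ≃+* ℂ) • x₀ ∧ σ • y = y)
    (hnd : IsNondegenerate (Φ i₁))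
    (hN : ¬ ∃ a b : ℕ, a ≠ b ∧ ∀ g : ℂ ≃+* ℂ,
      (Finset.univ.filter fun y : K i₁ →+* ℂ => y ∈ O ∧ g • y ∈ (Φ i₁).1).card =
        if g • x₀ ∈ (Φ i₀).1 then a else b)
    (hA : ∀ i, IsCMTypeRealisation (Φ i) (A i) (ι i) (θ i)) {N : ℕ} (π : Fin N → I) :
    HodgeConjectureFor (⨁ fun j : Fin N => A (π j)).dim (⨁ fun j : Fin N => A (π j)).X ∧
      ∀ m : ℕ, hodgeClassSpan (⨁ fun j : Fin N => A (π j)).dim (⨁ fun j : Fin N => A (π j)).X m =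
        divisorClassesSpan (⨁ fun j : Fin N => A (π j)).X (⨁ fun j : Fin N => A (π j)).dim m :=
  have h := (isNondegenerateFamily_iff_of_irreducible_of_orbit hI h01 hirr O hO hoff).2 ⟨hnd, hN⟩
  ⟨h.hodgeConjectureFor_prod hA π, fun m => h.hodgeClassSpan_prod_eq_divisorClassesSpan hA π m⟩

/-- **The Hodge conjecture on every `A₀^a × A₁^b`**, with `B• = D•`, for a realisation of a type of an (IRR) field and a
realisation of a NONDEGENERATE type of ANY CM field with NO coefficient vector — UNCONDITIONALLY.
[cite: Gordon1999HodgeAVSurvey, 7.5 and 10.10] -/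
theorem hodgeConjectureFor_prod_of_irreducible_of_not_exists_coeff (hI : ∀ i, i = i₀ ∨ i = i₁) (h01 : i₀ ≠ i₁)
    (hirr : ∀ W : Submodule ℚ ((K i₀ →+* ℂ) → ℚ), W ≤ antiWeights (E := K i₀ →+* ℂ) (starRingAut : ℂ ≃+* ℂ) →
      W ≠ ⊥ → (∀ (k : ℂ ≃+* ℂ) (f : (K i₀ →+* ℂ) → ℚ), f ∈ W → (fun y => f (k • y)) ∈ W) →
      W = antiWeights (E := K i₀ →+* ℂ) (starRingAut : ℂ ≃+* ℂ)) (x₀ : K i₀ →+* ℂ)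
    (hnd : IsNondegenerate (Φ i₁))
    (hnot : ¬ ∃ lam : (K i₁ →+* ℂ) → ℚ, ∀ g : ℂ ≃+* ℂ,
      ∑ y, lam y * antiVec (Φ i₁).1 (1 : ℂ ≃+* ℂ) (g • y) = antiVec (Φ i₀).1 (1 : ℂ ≃+* ℂ) (g • x₀))
    (hA : ∀ i, IsCMTypeRealisation (Φ i) (A i) (ι i) (θ i)) {N : ℕ} (π : Fin N → I) :
    HodgeConjectureFor (⨁ fun j : Fin N => A (π j)).dim (⨁ fun j : Fin N => A (π j)).X ∧
      ∀ m : ℕ, hodgeClassSpan (⨁ fun j : Fin N => A (π j)).dim (⨁ fun j : Fin N => A (π j)).X m =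
        divisorClassesSpan (⨁ fun j : Fin N => A (π j)).X (⨁ fun j : Fin N => A (π j)).dim m :=
  have h := (isNondegenerateFamily_iff_not_exists_coeff_of_irreducible hI h01 hirr x₀).2 ⟨hnd, hnot⟩
  ⟨h.hodgeConjectureFor_prod hA π, fun m => h.hodgeClassSpan_prod_eq_divisorClassesSpan hA π m⟩

/-- **The Hodge conjecture on every `A^a × B^b`** — `A = A_{i₀}` with CM by an (IRR) field, `B = A_{i₁}` any realisation
of a NONDEGENERATE type of a CM field of smaller degree: the Hodge conjecture and `B• = D•` on every `⨁_{j<N} A_{π j}`,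
UNCONDITIONALLY, with no hypothesis relating the two fields. [cite: Gordon1999HodgeAVSurvey, §3 Theorem and 10.10] -/
theorem hodgeConjectureFor_prod_of_irreducible_of_dim_lt (hI : ∀ i, i = i₀ ∨ i = i₁) (h01 : i₀ ≠ i₁)
    (hirr : ∀ W : Submodule ℚ ((K i₀ →+* ℂ) → ℚ), W ≤ antiWeights (E := K i₀ →+* ℂ) (starRingAut : ℂ ≃+* ℂ) →
      W ≠ ⊥ → (∀ (k : ℂ ≃+* ℂ) (f : (K i₀ →+* ℂ) → ℚ), f ∈ W → (fun y => f (k • y)) ∈ W) →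
      W = antiWeights (E := K i₀ →+* ℂ) (starRingAut : ℂ ≃+* ℂ))
    (hlt : finrank ℚ (K i₁) < finrank ℚ (K i₀)) (hnd : IsNondegenerate (Φ i₁))
    (hA : ∀ i, IsCMTypeRealisation (Φ i) (A i) (ι i) (θ i)) {N : ℕ} (π : Fin N → I) :
    HodgeConjectureFor (⨁ fun j : Fin N => A (π j)).dim (⨁ fun j : Fin N => A (π j)).X ∧
      ∀ m : ℕ, hodgeClassSpan (⨁ fun j : Fin N => A (π j)).dim (⨁ fun j : Fin N => A (π j)).X m =
        divisorClassesSpan (⨁ fun j : Fin N => A (π j)).X (⨁ fun j : Fin N => A (π j)).dim m :=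
  have h := (isNondegenerateFamily_iff_of_irreducible_of_finrank_lt h01 hI hirr hlt Φ).2 hnd
  ⟨h.hodgeConjectureFor_prod hA π, fun m => h.hodgeClassSpan_prod_eq_divisorClassesSpan hA π m⟩

/-- **SIMPLE, NON-ISOGENOUS realisations ((IRR) field against any CM field, one orbit): `B• = D•` on ALL products
`A₀^a × A₁^b` IFF `Φ₁` is nondegenerate and its orbit multiplicities are not constant-unequal**; otherwise some product
carries an exceptional Hodge class. [cite: Gordon1999HodgeAVSurvey, 7.5, 7.6.1 and 9.4.3] -/
theorem forall_prod_hodgeClassSpan_eq_iff_of_irreducible_of_orbit (hI : ∀ i, i = i₀ ∨ i = i₁) (h01 : i₀ ≠ i₁)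
    (hirr : ∀ W : Submodule ℚ ((K i₀ →+* ℂ) → ℚ), W ≤ antiWeights (E := K i₀ →+* ℂ) (starRingAut : ℂ ≃+* ℂ) →
      W ≠ ⊥ → (∀ (k : ℂ ≃+* ℂ) (f : (K i₀ →+* ℂ) → ℚ), f ∈ W → (fun y => f (k • y)) ∈ W) →
      W = antiWeights (E := K i₀ →+* ℂ) (starRingAut : ℂ ≃+* ℂ))
    {x₀ : K i₀ →+* ℂ} (O : Set (K i₁ →+* ℂ)) (hO : ∀ y ∈ O, ∀ y' ∈ O, ∃ g : ℂ ≃+* ℂ, g • x₀ = x₀ ∧ g • y = y')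
    (hoff : ∀ y : K i₁ →+* ℂ, y ∉ O → (starRingAut : ℂ ≃+* ℂ) • y ∉ O →
      ∃ σ : ℂ ≃+* ℂ, σ • x₀ = (starRingAut : ℂ ≃+* ℂ) • x₀ ∧ σ • y = y)
    (hA : ∀ i, IsCMTypeRealisation (Φ i) (A i) (ι i) (θ i)) (hs : ∀ i, (A i).IsSimple)
    (hniso : ∀ i i', i ≠ i' → ¬ AbelianVariety.IsIsogenous (A i) (A i')) :
    (∀ (N : ℕ) (π : Fin N → I) (m : ℕ),
      hodgeClassSpan (⨁ fun j : Fin N => A (π j)).dim (⨁ fun j : Fin N => A (π j)).X m =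
        divisorClassesSpan (⨁ fun j : Fin N => A (π j)).X (⨁ fun j : Fin N => A (π j)).dim m) ↔
      IsNondegenerate (Φ i₁) ∧ ¬ ∃ a b : ℕ, a ≠ b ∧ ∀ g : ℂ ≃+* ℂ,
        (Finset.univ.filter fun y : K i₁ →+* ℂ => y ∈ O ∧ g • y ∈ (Φ i₁).1).card =
          if g • x₀ ∈ (Φ i₀).1 then a else b := by
  rw [← CMAlgebra.isNondegenerateFamily_iff_forall_prod_hodgeClassSpan_eq
    (CMAlgebra.isSeparatingFamily_of_isSimple_of_pairwise_not_isIsogenous hA hs hniso) hA]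
  exact isNondegenerateFamily_iff_of_irreducible_of_orbit hI h01 hirr O hO hoff

/-- **SIMPLE, NON-ISOGENOUS realisations ((IRR) field against any CM field): `B• = D•` on ALL products `A₀^a × A₁^b`
IFF `Φ₁` is nondegenerate and no coefficient vector exists.** [cite: Gordon1999HodgeAVSurvey, 7.5 and 7.6.1] -/
theorem forall_prod_hodgeClassSpan_eq_iff_of_irreducible_coeff (hI : ∀ i, i = i₀ ∨ i = i₁) (h01 : i₀ ≠ i₁)
    (hirr : ∀ W : Submodule ℚ ((K i₀ →+* ℂ) → ℚ), W ≤ antiWeights (E := K i₀ →+* ℂ) (starRingAut : ℂ ≃+* ℂ) →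
      W ≠ ⊥ → (∀ (k : ℂ ≃+* ℂ) (f : (K i₀ →+* ℂ) → ℚ), f ∈ W → (fun y => f (k • y)) ∈ W) →
      W = antiWeights (E := K i₀ →+* ℂ) (starRingAut : ℂ ≃+* ℂ)) (x₀ : K i₀ →+* ℂ)
    (hA : ∀ i, IsCMTypeRealisation (Φ i) (A i) (ι i) (θ i)) (hs : ∀ i, (A i).IsSimple)
    (hniso : ∀ i i', i ≠ i' → ¬ AbelianVariety.IsIsogenous (A i) (A i')) :
    (∀ (N : ℕ) (π : Fin N → I) (m : ℕ),
      hodgeClassSpan (⨁ fun j : Fin N => A (π j)).dim (⨁ fun j : Fin N => A (π j)).X m =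
        divisorClassesSpan (⨁ fun j : Fin N => A (π j)).X (⨁ fun j : Fin N => A (π j)).dim m) ↔
      IsNondegenerate (Φ i₁) ∧ ¬ ∃ lam : (K i₁ →+* ℂ) → ℚ, ∀ g : ℂ ≃+* ℂ,
        ∑ y, lam y * antiVec (Φ i₁).1 (1 : ℂ ≃+* ℂ) (g • y) = antiVec (Φ i₀).1 (1 : ℂ ≃+* ℂ) (g • x₀) := by
  rw [← CMAlgebra.isNondegenerateFamily_iff_forall_prod_hodgeClassSpan_eq
    (CMAlgebra.isSeparatingFamily_of_isSimple_of_pairwise_not_isIsogenous hA hs hniso) hA]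
  exact isNondegenerateFamily_iff_not_exists_coeff_of_irreducible hI h01 hirr x₀

end Varieties

end Summit.HodgeConjecture.CorCM

end
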